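import Mathlib
import Summits.NavierStokesRegularity.NavierStokesRegularity.Theorems.LerayQuarterDissipationFiniteDissipationLiouvilleCrossFlowThreshold
import Summits.NavierStokesRegularity.NavierStokesRegularity.Theorems.LerayQuarterDissipationFiniteDissipationLiouvilleTrappingTools
import Summits.NavierStokesRegularity.NavierStokesRegularity.Theorems.DssFarFieldSlavingBlowupTypeIDssProfileGaussianGapTypeI
import HarnessLib

/-!
# Crux `FiniteDissipationLiouville` (stmt-NavierStokesRegularity-22144): THE TAYLOR-MICROSCALE WINDOW
# — the dissipation length of the hypothetical profile is pinned to the self-similar scale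

Theorems file of route `LerayQuarterDissipation` (lead prover g18; `--supports` the crux).
Navier–Stokes regularity is NOT proved by anything here; no summit is.

Every explicit clause of the line so far is an AMPLITUDE statement (thresholds on `C`, `K`, `C_ω`,
`V₃`, `V₆`, cross-flow, …). This file records a statement of a different kind, a LENGTH SCALE.
For an enveloped KNSS-gauge Type-I field `V` (constant `C`) write, in Leray's similarity variables,
`Z(s) = ∫‖Ω(s)‖²` (enstrophy) and `D(s) = ∫‖curl Ω(s)‖²` (palinstrophy); physically
`Z = √(−t)∫‖ω(t)‖²dx`, `D = (−t)^{3/2}∫‖∇ω(t)‖²dx`, so `D/Z = (−t)/λ(t)²` with the vorticity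
Taylor microscale `λ(t) = ‖ω(t)‖₂/‖∇ω(t)‖₂`. The global budget (`…CrossFlowDss`, lead g17) and the
pricing `Str = ∫⟪U, Ω × curl Ω⟫ ≤ C∫‖Ω‖‖curl Ω‖ ≤ C√Z√D` (`‖U‖ ≤ C`, Cauchy–Schwarz) give

  `Z' ≤ −2D − ½Z + 2C√Z√D = ½(C² − 1)Z − 2(√D − ½C√Z)²`.

* `integral_inner_lamb_le_typeI_sqrt` — `Str(s) ≤ C√Z(s)√D(s)`;
* `deriv_enstrophy_le_window` — the displayed budget (exact derivative from `…CrossFlowDss`);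
* `enstrophy_le_exp_mul` — GROWTH BOUND: `Z(s₂) ≤ e^{(C²−1)(s₂−s₁)/2} Z(s₁)` for `s₁ ≤ s₂`: the
  dimensionless enstrophy `√(−t)∫‖ω‖²` grows at most like `(−t)^{−(C²−1)/2}` (for `C < 1` it decays
  along the ancient orbit — the tree's T31⁗; for `C = 1` it is non-increasing);
* **`window_of_deriv_nonneg`** — **THE WINDOW: at every instant where `Z` is non-decreasing,
  `(4D + Z)² ≤ 16C²·Z·D`**, i.e. (for `Z > 0`) `D/Z ∈ [μ₋², μ₊²]` with `μ± = ½(C ± √(C²−1))`,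
  `μ₋μ₊ = ¼`: the microscale satisfies `2(C − √(C²−1))√(−t) ≤ λ(t) ≤ 2(C + √(C²−1))√(−t)`
  (empty for `C < 1`; `λ = 2√(−t)` exactly at `C = 1`) — the profile can be neither too smooth (the
  scaling term `−½Z` would win) nor too rough (the dissipation `−2D` would win);
* **`exists_near_window`** — RECURRENCE (mean value theorem): in every similarity-time window
  `[s₁, s₁ + L]` there is an instant with `2(√D − ½C√Z)² ≤ ½(C²−1)Z + Z(s₁)/L`; with the law
  (`Z ≤ ‖curlCLM‖²·max K 0`, `…Trapping`) the error is `≤ ‖curlCLM‖²K/L`, uniformly along the orbit.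

HONEST FRAMING. Explicit necessary conditions on a HYPOTHETICAL object (two-sided, in the
time-recurrent sense above; not at every instant); the window is what the energy method with the
crudest pricing `‖U‖ ≤ C` gives and is not claimed sharp; nothing is removed from the catalogued
DSS wall; verdict of the line unchanged (FRONTIER). Nothing here bears on Navier–Stokes regularity.

References: Koch–Nadirashvili–Seregin–Šverák, Acta Math. 203 (2009) §4; Doering–Gibbon (1995)
§1.4; Tennekes–Lumley (1972) §3.2 (Taylor microscale); folklore energy method.
-/

noncomputable section

set_option linter.dupNamespace false

namespace Summit.NavierStokesRegularity.NavierStokesRegularity.Theorems.FiniteDissipationLiouville.MicroscaleWindow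

open MeasureTheory Set Filter Topology Metric InnerProductSpace Function Real
open scoped RealInnerProductSpace ContDiff
open Literature.Analysis Literature.Analysis.FluidPDE
open Summit.NavierStokesRegularity.NavierStokesRegularity.Theorems
open Summit.NavierStokesRegularity.NavierStokesRegularity.Theorems.GaussianGap
open Summit.NavierStokesRegularity.NavierStokesRegularity.Theorems.SimilarityEnstrophy
open Summit.NavierStokesRegularity.NavierStokesRegularity.Theorems.SmallDissipationGap
open Summit.NavierStokesRegularity.NavierStokesRegularity.Theorems.FiniteDissipationLiouville
open Summit.NavierStokesRegularity.NavierStokesRegularity.Theorems.FiniteDissipationLiouville.CrossFlow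

variable {C : ℝ} {V : ℝ → EuclideanSpace ℝ (Fin 3) → EuclideanSpace ℝ (Fin 3)}

/-! ### The stretching priced by the Type-I constant, Cauchy–Schwarz form -/

section Stretching

/-- **`Str ≤ C√Z√D`.** For an enveloped KNSS-gauge Type-I field with constant `C`, at every
similarity time `∫⟪U, Ω × curl Ω⟫ ≤ C·√(∫‖Ω‖²)·√(∫‖curl Ω‖²)` (`‖U‖ ≤ C`, `‖Ω × curl Ω‖ ≤ ‖Ω‖‖curl Ω‖`,
Cauchy–Schwarz). [folklore energy method] -/
theorem integral_inner_lamb_le_typeI_sqrt (hV : IsTypeIAncientMild C V) (hdec : HasTypeIDecay C V)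
    (s : ℝ) :
    ∫ y, ⟪lerayOrbit V s y, cross (lerayVorticity V s y) (curl (lerayVorticity V s) y)⟫ ≤
      C * (Real.sqrt (∫ y, ‖lerayVorticity V s y‖ ^ 2) *
        Real.sqrt (∫ y, ‖curl (lerayVorticity V s) y‖ ^ 2)) := by
  obtain ⟨C₁, C₂, C₃, hD1, hD2, -⟩ := IsTypeIAncientMild.gaugeBounds_of_hasTypeIDecay hV hdec
  have hC : 0 ≤ C := hV.nonneg
  have iC := integrable_norm_curl_lerayVorticity_sq hV hD2 s
  have iZ := integrable_norm_lerayVorticity_sq hV hD1 s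
  have iΛ := integrable_inner_lerayOrbit_lamb hV hD1 hD2 s
  have hΩinf := contDiff_lerayVorticity_slice hV s
  have hΩc : Continuous (lerayVorticity V s) := hΩinf.continuous
  have hCc : Continuous (curl (lerayVorticity V s)) :=
    (contDiff_curl (n := 1) (hΩinf.of_le (by norm_cast))).continuous
  set f : EuclideanSpace ℝ (Fin 3) → ℝ := fun y => ‖lerayVorticity V s y‖ with hf
  set g : EuclideanSpace ℝ (Fin 3) → ℝ := fun y => ‖curl (lerayVorticity V s) y‖ with hg
  have hfc : Continuous f := hΩc.norm
  have hgc : Continuous g := hCc.norm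
  -- `f, g ∈ L²`
  have hfm : MemLp f (ENNReal.ofReal 2) volume := by
    rw [ENNReal.ofReal_ofNat]
    refine (memLp_two_iff_integrable_sq hfc.aestronglyMeasurable).2 ?_
    exact iZ.congr (Eventually.of_forall fun y => by simp [hf])
  have hgm : MemLp g (ENNReal.ofReal 2) volume := by
    rw [ENNReal.ofReal_ofNat]
    refine (memLp_two_iff_integrable_sq hgc.aestronglyMeasurable).2 ?_
    exact iC.congr (Eventually.of_forall fun y => by simp [hg])
  -- the product is integrable (`fg ≤ (f² + g²)/2`)
  have ifg : Integrable fun y => f y * g y := by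
    refine Integrable.mono' ((iZ.add iC).div_const 2) (hfc.mul hgc).aestronglyMeasurable
      (Eventually.of_forall fun y => ?_)
    rw [Real.norm_of_nonneg (mul_nonneg (norm_nonneg _) (norm_nonneg _))]
    change ‖lerayVorticity V s y‖ * ‖curl (lerayVorticity V s) y‖ ≤
      (‖lerayVorticity V s y‖ ^ 2 + ‖curl (lerayVorticity V s) y‖ ^ 2) / 2
    nlinarith [sq_nonneg (‖lerayVorticity V s y‖ - ‖curl (lerayVorticity V s) y‖)]
  -- Cauchy–Schwarz
  have hCS : ∫ y, f y * g y ≤ Real.sqrt (∫ y, ‖lerayVorticity V s y‖ ^ 2) *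
      Real.sqrt (∫ y, ‖curl (lerayVorticity V s) y‖ ^ 2) := by
    have h := integral_mul_le_Lp_mul_Lq_of_nonneg Real.HolderConjugate.two_two
      (Eventually.of_forall fun y => norm_nonneg _) (Eventually.of_forall fun y => norm_nonneg _)
      hfm hgm
    have e1 : ∫ y, f y ^ (2 : ℝ) = ∫ y, ‖lerayVorticity V s y‖ ^ 2 :=
      integral_congr_ae (Eventually.of_forall fun y => by
        show ‖lerayVorticity V s y‖ ^ (2 : ℝ) = ‖lerayVorticity V s y‖ ^ 2
        rw [Real.rpow_two])
    have e2 : ∫ y, g y ^ (2 : ℝ) = ∫ y, ‖curl (lerayVorticity V s) y‖ ^ 2 :=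
      integral_congr_ae (Eventually.of_forall fun y => by
        show ‖curl (lerayVorticity V s) y‖ ^ (2 : ℝ) = ‖curl (lerayVorticity V s) y‖ ^ 2
        rw [Real.rpow_two])
    rw [e1, e2, ← Real.sqrt_eq_rpow, ← Real.sqrt_eq_rpow] at h
    exact h
  -- pointwise pricing
  have hpt : ∀ y, ⟪lerayOrbit V s y, cross (lerayVorticity V s y) (curl (lerayVorticity V s) y)⟫ ≤
      C * (f y * g y) := by
    intro y
    calc ⟪lerayOrbit V s y, cross (lerayVorticity V s y) (curl (lerayVorticity V s) y)⟫
        ≤ ‖lerayOrbit V s y‖ * ‖cross (lerayVorticity V s y) (curl (lerayVorticity V s) y)‖ :=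
          real_inner_le_norm _ _
      _ ≤ C * (f y * g y) := mul_le_mul (norm_lerayOrbit_le_of_typeI hV s y)
          (norm_cross_le_norm_mul_norm _ _) (norm_nonneg _) hC
  calc ∫ y, ⟪lerayOrbit V s y, cross (lerayVorticity V s y) (curl (lerayVorticity V s) y)⟫
      ≤ ∫ y, C * (f y * g y) := integral_mono iΛ (ifg.const_mul C) hpt
    _ = C * ∫ y, f y * g y := integral_const_mul _ _
    _ ≤ _ := mul_le_mul_of_nonneg_left hCS hC

end Stretching

/-! ### The budget with the completed square -/

section Budget

/-- **The similarity-enstrophy budget priced by the Type-I constant.** For an enveloped KNSS-gauge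
Type-I field with constant `C`: `Z` is differentiable and
`Z'(s) ≤ −2D(s) − ½Z(s) + 2C√Z(s)√D(s)` (`= ½(C²−1)Z − 2(√D − ½C√Z)²`).
[folklore energy method] -/
theorem deriv_enstrophy_le_window (hV : IsTypeIAncientMild C V) (hdec : HasTypeIDecay C V) (s : ℝ) :
    deriv (fun σ => ∫ y, ‖lerayVorticity V σ y‖ ^ 2) s ≤
      -2 * (∫ y, ‖curl (lerayVorticity V s) y‖ ^ 2) - (1 / 2) * (∫ y, ‖lerayVorticity V s y‖ ^ 2) +
        2 * C * (Real.sqrt (∫ y, ‖lerayVorticity V s y‖ ^ 2) *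
          Real.sqrt (∫ y, ‖curl (lerayVorticity V s) y‖ ^ 2)) := by
  obtain ⟨C₁, C₂, C₃, hD1, hD2, -⟩ := IsTypeIAncientMild.gaugeBounds_of_hasTypeIDecay hV hdec
  have hd := hasDerivAt_enstrophy_eq_neg_two_integral_slack hV hdec s
  rw [hd.deriv]
  have iC := integrable_norm_curl_lerayVorticity_sq hV hD2 s
  have iZ := integrable_norm_lerayVorticity_sq hV hD1 s
  have iΛ := integrable_inner_lerayOrbit_lamb hV hD1 hD2 s
  have iZ' : Integrable fun y => (1 / 4 : ℝ) * ‖lerayVorticity V s y‖ ^ 2 := iZ.const_mul _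
  have iAB : Integrable fun y => ‖curl (lerayVorticity V s) y‖ ^ 2 +
      (1 / 4 : ℝ) * ‖lerayVorticity V s y‖ ^ 2 := iC.add iZ'
  have e : (∫ y, (‖curl (lerayVorticity V s) y‖ ^ 2 + (1 / 4) * ‖lerayVorticity V s y‖ ^ 2 -
      ⟪lerayOrbit V s y, cross (lerayVorticity V s y) (curl (lerayVorticity V s) y)⟫)) =
      (∫ y, ‖curl (lerayVorticity V s) y‖ ^ 2) + (1 / 4) * (∫ y, ‖lerayVorticity V s y‖ ^ 2) -
        ∫ y, ⟪lerayOrbit V s y, cross (lerayVorticity V s y) (curl (lerayVorticity V s) y)⟫ := by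
    rw [integral_sub iAB iΛ, integral_add iC iZ', integral_const_mul]
  rw [e]
  have h := integral_inner_lamb_le_typeI_sqrt hV hdec s
  nlinarith

/-- The `HasDerivAt` form of the enstrophy (for use with the mean value theorem). [folklore] -/
theorem differentiable_enstrophy (hV : IsTypeIAncientMild C V) (hdec : HasTypeIDecay C V) :
    Differentiable ℝ fun σ => ∫ y, ‖lerayVorticity V σ y‖ ^ 2 := fun s =>
  (hasDerivAt_enstrophy_eq_neg_two_integral_slack hV hdec s).differentiableAt

/-- **The completed square**: `Z' ≤ ½(C²−1)Z − 2(√D − ½C√Z)²`. [folklore] -/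
theorem deriv_enstrophy_le_sq (hV : IsTypeIAncientMild C V) (hdec : HasTypeIDecay C V) (s : ℝ) :
    deriv (fun σ => ∫ y, ‖lerayVorticity V σ y‖ ^ 2) s ≤
      (1 / 2) * (C ^ 2 - 1) * (∫ y, ‖lerayVorticity V s y‖ ^ 2) -
        2 * (Real.sqrt (∫ y, ‖curl (lerayVorticity V s) y‖ ^ 2) -
          (1 / 2) * C * Real.sqrt (∫ y, ‖lerayVorticity V s y‖ ^ 2)) ^ 2 := by
  have h := deriv_enstrophy_le_window hV hdec s
  have hZ : 0 ≤ ∫ y, ‖lerayVorticity V s y‖ ^ 2 := integral_nonneg fun y => sq_nonneg _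
  have hD : 0 ≤ ∫ y, ‖curl (lerayVorticity V s) y‖ ^ 2 := integral_nonneg fun y => sq_nonneg _
  have e1 := Real.sq_sqrt hZ
  have e2 := Real.sq_sqrt hD
  nlinarith

/-- **GROWTH BOUND**: `Z' ≤ ½(C²−1)Z`, hence `Z(s₂) ≤ e^{(C²−1)(s₂−s₁)/2}Z(s₁)` for `s₁ ≤ s₂` — the
dimensionless enstrophy `√(−t)∫‖ω(t)‖²` cannot grow faster than `(−t)^{−(C²−1)/2}` toward the apex.
[folklore energy method] -/
theorem enstrophy_le_exp_mul (hV : IsTypeIAncientMild C V) (hdec : HasTypeIDecay C V) {s₁ s₂ : ℝ}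
    (h12 : s₁ ≤ s₂) :
    (∫ y, ‖lerayVorticity V s₂ y‖ ^ 2) ≤
      Real.exp ((1 / 2) * (C ^ 2 - 1) * (s₂ - s₁)) * ∫ y, ‖lerayVorticity V s₁ y‖ ^ 2 := by
  set Z : ℝ → ℝ := fun σ => ∫ y, ‖lerayVorticity V σ y‖ ^ 2 with hZdef
  have hd := differentiable_enstrophy hV hdec
  have hle : ∀ σ, deriv Z σ ≤ (1 / 2) * (C ^ 2 - 1) * Z σ := fun σ =>
    (deriv_enstrophy_le_sq hV hdec σ).trans (by nlinarith [sq_nonneg (Real.sqrt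
      (∫ y, ‖curl (lerayVorticity V σ) y‖ ^ 2) - (1 / 2) * C * Real.sqrt (∫ y, ‖lerayVorticity V σ y‖ ^ 2))])
  rcases eq_or_ne ((1 / 2) * (C ^ 2 - 1)) 0 with h0 | h0
  · -- `C² = 1`: `Z` is antitone
    have hanti : Antitone Z := antitone_of_deriv_nonpos hd fun σ => by
      have := hle σ; rw [h0, zero_mul] at this; exact this
    have := hanti h12
    rw [h0, zero_mul, Real.exp_zero, one_mul]
    exact this
  · have h := Trapping.le_of_deriv_le_mul_add_Icc hd (b := 0) (s₀ := s₁) (s₁ := s₂) h0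
      (fun σ _ => by rw [add_zero]; exact hle σ) s₂ ⟨h12, le_rfl⟩
    simpa [zero_div] using h

end Budget

/-! ### The window -/

section Window

/-- **THE TAYLOR-MICROSCALE WINDOW.** For an enveloped KNSS-gauge Type-I field with constant `C`, at
every similarity time `s` where the enstrophy is non-decreasing (`Z'(s) ≥ 0`):
`(4D + Z)² ≤ 16C²·Z·D` (`Z = ∫‖Ω(s)‖²`, `D = ∫‖curl Ω(s)‖²`), i.e. for `Z > 0` the ratio `D/Z`
lies between `((C − √(C²−1))/2)²` and `((C + √(C²−1))/2)²`. [folklore energy method] -/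
theorem window_of_deriv_nonneg (hV : IsTypeIAncientMild C V) (hdec : HasTypeIDecay C V) {s : ℝ}
    (hs : 0 ≤ deriv (fun σ => ∫ y, ‖lerayVorticity V σ y‖ ^ 2) s) :
    (4 * (∫ y, ‖curl (lerayVorticity V s) y‖ ^ 2) + ∫ y, ‖lerayVorticity V s y‖ ^ 2) ^ 2 ≤
      16 * C ^ 2 * ((∫ y, ‖lerayVorticity V s y‖ ^ 2) * ∫ y, ‖curl (lerayVorticity V s) y‖ ^ 2) := by
  have h := deriv_enstrophy_le_window hV hdec s
  set Z : ℝ := ∫ y, ‖lerayVorticity V s y‖ ^ 2 with hZ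
  set D : ℝ := ∫ y, ‖curl (lerayVorticity V s) y‖ ^ 2 with hD
  have hZ0 : 0 ≤ Z := integral_nonneg fun y => sq_nonneg _
  have hD0 : 0 ≤ D := integral_nonneg fun y => sq_nonneg _
  have hC : 0 ≤ C := hV.nonneg
  have eZ := Real.sq_sqrt hZ0
  have eD := Real.sq_sqrt hD0
  have hsZ := Real.sqrt_nonneg Z
  have hsD := Real.sqrt_nonneg D
  -- `4D + Z ≤ 4C√Z√D`, both sides nonnegative; square
  have h1 : 4 * D + Z ≤ 4 * C * (Real.sqrt Z * Real.sqrt D) := by linarith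
  have h2 : 0 ≤ 4 * D + Z := by linarith
  have h3 := mul_self_le_mul_self h2 h1
  have e : 4 * C * (Real.sqrt Z * Real.sqrt D) * (4 * C * (Real.sqrt Z * Real.sqrt D)) =
      16 * C ^ 2 * (Z * D) := by
    have : Real.sqrt Z * Real.sqrt D * (Real.sqrt Z * Real.sqrt D) = Z * D := by
      rw [show Real.sqrt Z * Real.sqrt D * (Real.sqrt Z * Real.sqrt D) =
        (Real.sqrt Z) ^ 2 * (Real.sqrt D) ^ 2 by ring, eZ, eD]
    calc 4 * C * (Real.sqrt Z * Real.sqrt D) * (4 * C * (Real.sqrt Z * Real.sqrt D))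
        = 16 * C ^ 2 * (Real.sqrt Z * Real.sqrt D * (Real.sqrt Z * Real.sqrt D)) := by ring
      _ = 16 * C ^ 2 * (Z * D) := by rw [this]
  rw [← sq, e] at h3
  exact h3

/-- **Ratio form of the window**: with `Z > 0` and `r = D/Z`, `4r² − (4C² − 2)r + ¼ ≤ 0`, i.e.
`|√r − C/2| ≤ ½√(C²−1)` — in physical variables `λ(t)/√(−t) ∈ [2(C−√(C²−1)), 2(C+√(C²−1))]` for
the vorticity Taylor microscale `λ = ‖ω‖₂/‖∇ω‖₂`. [folklore] -/
theorem ratio_window_of_deriv_nonneg (hV : IsTypeIAncientMild C V) (hdec : HasTypeIDecay C V)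
    {s : ℝ} (hs : 0 ≤ deriv (fun σ => ∫ y, ‖lerayVorticity V σ y‖ ^ 2) s)
    (hZ : 0 < ∫ y, ‖lerayVorticity V s y‖ ^ 2) :
    4 * ((∫ y, ‖curl (lerayVorticity V s) y‖ ^ 2) / ∫ y, ‖lerayVorticity V s y‖ ^ 2) ^ 2 -
        (4 * C ^ 2 - 2) * ((∫ y, ‖curl (lerayVorticity V s) y‖ ^ 2) / ∫ y, ‖lerayVorticity V s y‖ ^ 2) +
      1 / 4 ≤ 0 := by
  have h := window_of_deriv_nonneg hV hdec hs
  set Z : ℝ := ∫ y, ‖lerayVorticity V s y‖ ^ 2 with hZdef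
  set D : ℝ := ∫ y, ‖curl (lerayVorticity V s) y‖ ^ 2 with hDdef
  have hZ2 : 0 < Z ^ 2 := by positivity
  -- divide the window inequality by `4Z²`
  have key : (4 * D + Z) ^ 2 / (4 * Z ^ 2) ≤ 16 * C ^ 2 * (Z * D) / (4 * Z ^ 2) :=
    div_le_div_of_nonneg_right h (by positivity)
  have e1 : (4 * D + Z) ^ 2 / (4 * Z ^ 2) = 4 * (D / Z) ^ 2 + 2 * (D / Z) + 1 / 4 := by
    field_simp
    ring
  have e2 : 16 * C ^ 2 * (Z * D) / (4 * Z ^ 2) = 4 * C ^ 2 * (D / Z) := by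
    field_simp
    ring
  rw [e1, e2] at key
  linarith

/-- **Below threshold one the enstrophy never increases** (and an instant with `Z' ≥ 0` forces
`Z = 0` there): the window is empty for `C < 1`. (Consistency with the tree's T31⁗.) [folklore] -/
theorem enstrophy_eq_zero_of_deriv_nonneg_of_lt_one (hV : IsTypeIAncientMild C V)
    (hdec : HasTypeIDecay C V) (hC1 : C < 1) {s : ℝ}
    (hs : 0 ≤ deriv (fun σ => ∫ y, ‖lerayVorticity V σ y‖ ^ 2) s) :
    (∫ y, ‖lerayVorticity V s y‖ ^ 2) = 0 := by
  have h := deriv_enstrophy_le_sq hV hdec s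
  have hZ0 : 0 ≤ ∫ y, ‖lerayVorticity V s y‖ ^ 2 := integral_nonneg fun y => sq_nonneg _
  have hC : 0 ≤ C := hV.nonneg
  have hneg : (1 / 2) * (C ^ 2 - 1) < 0 := by nlinarith
  by_contra hne
  have hpos : 0 < ∫ y, ‖lerayVorticity V s y‖ ^ 2 := lt_of_le_of_ne hZ0 (Ne.symm hne)
  nlinarith [sq_nonneg (Real.sqrt (∫ y, ‖curl (lerayVorticity V s) y‖ ^ 2) -
    (1 / 2) * C * Real.sqrt (∫ y, ‖lerayVorticity V s y‖ ^ 2)), mul_neg_of_neg_of_pos hneg hpos]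

end Window

/-! ### Recurrence of the window -/

section Recurrence

/-- **THE WINDOW RECURS IN EVERY LOG-TIME INTERVAL.** For an enveloped KNSS-gauge Type-I field with
constant `C`, every `s₁` and every `L > 0`: some `ξ ∈ [s₁, s₁ + L]` has
`2(√D(ξ) − ½C√Z(ξ))² ≤ ½(C²−1)Z(ξ) + Z(s₁)/L` (mean value theorem: `Z'(ξ) = (Z(s₁+L) − Z(s₁))/L ≥
−Z(s₁)/L` since `Z ≥ 0`). [folklore energy method] -/
theorem exists_near_window (hV : IsTypeIAncientMild C V) (hdec : HasTypeIDecay C V) (s₁ : ℝ) {L : ℝ}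
    (hL : 0 < L) :
    ∃ ξ ∈ Icc s₁ (s₁ + L),
      2 * (Real.sqrt (∫ y, ‖curl (lerayVorticity V ξ) y‖ ^ 2) -
          (1 / 2) * C * Real.sqrt (∫ y, ‖lerayVorticity V ξ y‖ ^ 2)) ^ 2 ≤
        (1 / 2) * (C ^ 2 - 1) * (∫ y, ‖lerayVorticity V ξ y‖ ^ 2) +
          (∫ y, ‖lerayVorticity V s₁ y‖ ^ 2) / L := by
  set Z : ℝ → ℝ := fun σ => ∫ y, ‖lerayVorticity V σ y‖ ^ 2 with hZdef
  have hd := differentiable_enstrophy hV hdec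
  have hlt : s₁ < s₁ + L := by linarith
  -- mean value theorem
  obtain ⟨ξ, hξ, hslope⟩ := exists_deriv_eq_slope Z hlt hd.continuous.continuousOn
    (hd.differentiableOn)
  refine ⟨ξ, Ioo_subset_Icc_self hξ, ?_⟩
  have hZL : 0 ≤ Z (s₁ + L) := integral_nonneg fun y => sq_nonneg _
  have hlow : -(Z s₁ / L) ≤ deriv Z ξ := by
    rw [hslope, show s₁ + L - s₁ = L by ring]
    rw [show -(Z s₁ / L) = (0 - Z s₁) / L by ring]
    exact div_le_div_of_nonneg_right (by linarith) hL.le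
  have hsq := deriv_enstrophy_le_sq hV hdec ξ
  have : deriv Z ξ = deriv (fun σ => ∫ y, ‖lerayVorticity V σ y‖ ^ 2) ξ := rfl
  rw [this] at hlow
  show 2 * (Real.sqrt (∫ y, ‖curl (lerayVorticity V ξ) y‖ ^ 2) -
      (1 / 2) * C * Real.sqrt (∫ y, ‖lerayVorticity V ξ y‖ ^ 2)) ^ 2 ≤
    (1 / 2) * (C ^ 2 - 1) * (∫ y, ‖lerayVorticity V ξ y‖ ^ 2) + Z s₁ / L
  linarith

end Recurrence

end Summit.NavierStokesRegularity.NavierStokesRegularity.Theorems.FiniteDissipationLiouville.MicroscaleWindow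

end
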